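import Summits.QuantumFields.YangMills.Theorems.FluctuationComparisonRegPrIntLS2BetaTubularChartAct
import Summits.QuantumFields.YangMills.Theorems.FluctuationComparisonRegPrIntLS2BetaTubularChartActSmooth
import Summits.QuantumFields.YangMills.Theorems.FluctuationComparisonRegPrIntLS2BetaResidualSubgroup
import Summits.QuantumFields.YangMills.Theorems.FluctuationComparisonRegPrIntLS2BetaLaplaceInstGroupChart
import HarnessLib

/-!
# LINE g18-1 S2β LAPLACE — DOCKING THE (C3β″) CHART ON LIMIT-INST's BINDERS (`S := residualSubgroup F hJK`, `act := pivotAct F hJK (βₖ)`)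

Crux `stmt-QuantumFields-20520` (`…Theses.UnitScaleTilt.FluctuationComparisonRegPrIntL`).  w5-20520 g13's ✓`…S2BetaLaplaceInst.laplaceLimit_of_charts` is
generic in a compact subgroup `S` of `SU(2)^{sites}` and an action `act`, and reads the tubular chart through the rows `he he1 he𝓝 hσ hΘ'𝓝 hWo hinj
hJc hJ0 hchart hρ hρW hJ00`, with `e : ℝ^{dZ} → ↥S × SU(2)^{pivots}` valued IN THE SUBGROUP and the two neighbourhood rows in FILTER form.  This file
turns ✓`…S2BetaTubularChartAct.exists_tubularHaarChart_act` (p738525; `e` valued in the rooted transformations, neighbourhood rows in `∀ s ∈ 𝓝`-form)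
into exactly those rows for `S := residualSubgroup F hJK`, `act := pivotAct F hJK (iterCentralBond (K − J))` (px11 g9's convention of record):

* the `e`-rows (`Continuous`, `e 0 = 1`, `𝓝 1 ≤ map e (𝓝 0)` in `↥S × SU(2)^{pivots}`) are w5-20520 g13's ✓`…S2BetaLaplaceInstGroupChart.groupChart_rows_of_rooted`
  (rooted ⇒ residual; near `1` residual = rooted because the centre of `SU(2)` is `{±1}`) applied to the letter's rows;
* `exists_tubularHaarChart_pivotAct`: ALL chart rows at once — the three `e`-rows, `Continuous σ`, `σ 0 = U₀`, `𝓝 (σ 0) ≤ map Θ (𝓝 0)`, `IsOpen W`,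
  `InjOn Θ W`, `ContinuousOn Jd W`, `Jd ≥ 0`, the chart identity for `Θ p := pivotAct … (e p.1) (σ p.2)` (= the letter's tube map by `rfl`), `0 < ρ`,
  `closedBall 0 ρ ×ˢ {0} ⊆ W` and `hJ00 : 0 < ∫ z in ball 0 ρ, Jd (z, 0)` (continuity and positivity of `Jd` at the origin, `ρ` shrunk accordingly).
[cite: Balaban1985Variational, Thm 1 (8)-(10) p.279, (4) p.278; Balaban1987RG1, p.256; Helgason2000, Ch. I §1 Thm 1.14 (13) p.96]
-/

noncomputable section

open MeasureTheory MeasureTheory.Measure Filter Topology Set Function Metric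
open scoped ENNReal Matrix.Norms.L2Operator
open Literature.MathematicalPhysics.QuantumFieldTheory.Balaban1983to89
open Literature.MathematicalPhysics.QuantumFieldTheory.Balaban1983to89.T3ContinuumYM3Torus
open Literature.MathematicalPhysics.QuantumFieldTheory.Balaban1983to89.T3UnitLawDensityEML
open Literature.MathematicalPhysics.QuantumFieldTheory.Balaban1983to89.T3TiltDescent
open Literature.MathematicalPhysics.QuantumFieldTheory.Balaban1983to89.B15DeterminingSets (embIter)
open Literature.MathematicalPhysics.QuantumFieldTheory.Balaban1983to89.B12GaugeOrbits021 (IsResidual)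
open scoped Literature.MathematicalPhysics.QuantumFieldTheory.Balaban1983to89.T3OrbitAverage
open Summit.QuantumFields.YangMills.Theorems.FluctuationComparisonRegPrIntLWregChain (iterCentralBond)
open Summit.QuantumFields.YangMills.Theorems.FluctuationComparisonRegPrIntLS2BetaResidualSubgroup
open Summit.QuantumFields.YangMills.Theorems.FluctuationComparisonRegPrIntLS2BetaResidualGaugeRooted
open Summit.QuantumFields.YangMills.Theorems.FluctuationComparisonRegPrIntLS2BetaLaplaceInstGroupChart
open Summit.QuantumFields.YangMills.Theorems.FluctuationComparisonRegPrIntLS2BetaTubularChartAct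
open Summit.QuantumFields.YangMills.Theorems.FluctuationComparisonRegPrIntLS2BetaTubularChartActSmooth

namespace Summit.QuantumFields.YangMills.Theorems.FluctuationComparisonRegPrIntLS2BetaTubularChartDock

variable (F : T3Family) {J K : ℕ} (hJK : J ≤ K)

/-! ## The docked chart rows -/

/-- ★★★ **THE (C3β″) CHART, DOCKED ON LIMIT-INST's BINDERS**: for `S := residualSubgroup F hJK`, `act := pivotAct F hJK (iterCentralBond (K − J))` and every base
point `U₀`, Euclidean models `ℝ^{dZ}`, `ℝ^{dV}` at the letter's dimensions, `e : ℝ^{dZ} → ↥S × SU(2)^{pivots}` continuous with `e 0 = 1` and `𝓝 1 ≤ map e (𝓝 0)`, a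
continuous transversal `σ` through `U₀` with `𝓝 (σ 0) ≤ map (act ∘ (e × σ)) (𝓝 0)`, an open window `W` on which `act (e ·) (σ ·)` is injective, a density
`Jd ≥ 0` continuous on `W` with `dU|_{image} = Θ_*((Jd · vol ⊗ vol)|_W)`, and a radius `ρ > 0` with `closedBall 0 ρ ×ˢ {0} ⊆ W` and `0 < ∫_{ball 0 ρ} Jd(z,0) dz`.
[cite: Balaban1985Variational, Thm 1 (8)-(10) p.279; Helgason2000, Ch. I §1 Thm 1.14 (13) p.96; Balaban1985Averaging, (8), (10) p.18] -/
theorem exists_tubularHaarChart_pivotAct (hk : K - J ≤ (F.P K).m + (F.P K).K) (dZ dV : ℕ)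
    (hdZ : dZ = Module.finrank ℝ (specialUnitaryLogChart (Fin 2)).lie *
      ((Fintype.card (Site (F.P K) 0) - Fintype.card (Site (F.P K) (K - J))) + Fintype.card (PBond (F.P K) (K - J))))
    (hdV : dV = Module.finrank ℝ (specialUnitaryLogChart (Fin 2)).lie *
        (Fintype.card (PBond (F.P K) 0) - Fintype.card (PBond (F.P K) (K - J))) -
      Module.finrank ℝ (specialUnitaryLogChart (Fin 2)).lie * (Fintype.card (Site (F.P K) 0) - Fintype.card (Site (F.P K) (K - J))))
    (U₀ : GaugeField (F.P K) 0 (Matrix.specialUnitaryGroup (Fin 2) ℂ)) :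
    ∃ (e : EuclideanSpace ℝ (Fin dZ) → residualSubgroup F hJK × (PBond (F.P K) (K - J) → Matrix.specialUnitaryGroup (Fin 2) ℂ))
      (σ : EuclideanSpace ℝ (Fin dV) → GaugeField (F.P K) 0 (Matrix.specialUnitaryGroup (Fin 2) ℂ))
      (W : Set (EuclideanSpace ℝ (Fin dZ) × EuclideanSpace ℝ (Fin dV)))
      (Jd : EuclideanSpace ℝ (Fin dZ) × EuclideanSpace ℝ (Fin dV) → ℝ) (ρ : ℝ),
      Continuous e ∧ e 0 = 1 ∧
      𝓝 (1 : residualSubgroup F hJK × (PBond (F.P K) (K - J) → Matrix.specialUnitaryGroup (Fin 2) ℂ)) ≤ map e (𝓝 0) ∧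
      Continuous σ ∧ σ 0 = U₀ ∧
      𝓝 (σ 0) ≤ map (fun p : EuclideanSpace ℝ (Fin dZ) × EuclideanSpace ℝ (Fin dV) =>
        pivotAct F hJK (iterCentralBond (P := F.P K) (K - J)) (e p.1) (σ p.2)) (𝓝 0) ∧
      IsOpen W ∧
      InjOn (fun p : EuclideanSpace ℝ (Fin dZ) × EuclideanSpace ℝ (Fin dV) =>
        pivotAct F hJK (iterCentralBond (P := F.P K) (K - J)) (e p.1) (σ p.2)) W ∧
      ContinuousOn Jd W ∧ (∀ w ∈ W, 0 ≤ Jd w) ∧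
      (fieldMeasure (F.P K) 0 (Matrix.specialUnitaryGroup (Fin 2) ℂ)).restrict
          ((fun p : EuclideanSpace ℝ (Fin dZ) × EuclideanSpace ℝ (Fin dV) =>
            pivotAct F hJK (iterCentralBond (P := F.P K) (K - J)) (e p.1) (σ p.2)) '' W) =
        ((((volume : Measure (EuclideanSpace ℝ (Fin dZ))).prod (volume : Measure (EuclideanSpace ℝ (Fin dV)))).restrict W).withDensity
            fun w => ENNReal.ofReal (Jd w)).map
          (fun p : EuclideanSpace ℝ (Fin dZ) × EuclideanSpace ℝ (Fin dV) =>
            pivotAct F hJK (iterCentralBond (P := F.P K) (K - J)) (e p.1) (σ p.2)) ∧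
      0 < ρ ∧ closedBall (0 : EuclideanSpace ℝ (Fin dZ)) ρ ×ˢ {(0 : EuclideanSpace ℝ (Fin dV))} ⊆ W ∧
      0 < ∫ z in ball (0 : EuclideanSpace ℝ (Fin dZ)) ρ, Jd (z, 0) := by
  obtain ⟨e, σ, W, Jd, ρ₀, hec, he0, heres, hsurj, hσc, hσ0, hWo, hρ₀, hball, hinj, hopen, hJc, hJ0, hJpos, hchart⟩ :=
    exists_tubularHaarChart_act (F.P K) hk dZ dV hdZ hdV U₀
  -- lift `e` into the subgroup (rooted ⇒ residual, px11's GAP 4)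
  set el : EuclideanSpace ℝ (Fin dZ) → residualSubgroup F hJK × (PBond (F.P K) (K - J) → Matrix.specialUnitaryGroup (Fin 2) ℂ) :=
    fun z => (⟨(e z).1, residual_of_isResidual F hJK (heres z)⟩, (e z).2) with hel
  -- the action of record through the lift IS the letter's tube map (definitionally)
  have hΘ : (fun p : EuclideanSpace ℝ (Fin dZ) × EuclideanSpace ℝ (Fin dV) =>
      pivotAct F hJK (iterCentralBond (P := F.P K) (K - J)) (el p.1) (σ p.2)) =
      fun p => Function.extend (iterCentralBond (P := F.P K) (K - J)) (fun c => (e p.1).2 c * σ p.2 (iterCentralBond (P := F.P K) (K - J) c))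
        (GaugeField.gaugeAct (e p.1).1 (σ p.2)) := by
    funext p; rfl
  -- (0,0) ∈ W and continuity of `Jd` there; shrink the radius so that `J(z,0) > J(0,0)/2` on the ball
  have h0W : ((0 : EuclideanSpace ℝ (Fin dZ)), (0 : EuclideanSpace ℝ (Fin dV))) ∈ W :=
    hball (Set.mk_mem_prod (Metric.mem_closedBall_self hρ₀.le) rfl)
  have hJat : ContinuousAt Jd ((0 : EuclideanSpace ℝ (Fin dZ)), (0 : EuclideanSpace ℝ (Fin dV))) :=
    hJc.continuousAt (hWo.mem_nhds h0W)
  obtain ⟨δ, hδ, hδJ⟩ := Metric.continuousAt_iff.1 hJat (Jd (0, 0) / 2) (by linarith)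
  set ρ : ℝ := min ρ₀ (δ / 2) with hρ
  have hρpos : 0 < ρ := lt_min hρ₀ (by linarith)
  have hρle : ρ ≤ ρ₀ := min_le_left _ _
  have hρδ : ρ < δ := lt_of_le_of_lt (min_le_right _ _) (by linarith)
  have hballW : closedBall (0 : EuclideanSpace ℝ (Fin dZ)) ρ ×ˢ {(0 : EuclideanSpace ℝ (Fin dV))} ⊆ W :=
    (Set.prod_mono (Metric.closedBall_subset_closedBall hρle) Subset.rfl).trans hball
  -- lower bound `J(z,0) ≥ J(0,0)/2` on the ball
  have hlow : ∀ z ∈ ball (0 : EuclideanSpace ℝ (Fin dZ)) ρ, Jd (0, 0) / 2 ≤ Jd (z, 0) := by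
    intro z hz
    have hd : dist ((z, (0 : EuclideanSpace ℝ (Fin dV))) : EuclideanSpace ℝ (Fin dZ) × EuclideanSpace ℝ (Fin dV)) (0, 0) < δ := by
      rw [Prod.dist_eq, dist_self]
      exact max_lt (lt_trans (mem_ball.1 hz) hρδ) hδ
    have := hδJ hd
    rw [Real.dist_eq] at this
    have := (abs_lt.1 this).1
    linarith
  refine ⟨el, σ, W, Jd, ρ, ?_, ?_, ?_, hσc, hσ0, ?_, hWo, ?_, hJc, hJ0, ?_, hρpos, hballW, ?_⟩
  · -- `el` continuous (w5's packaged row)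
    exact (groupChart_rows_of_rooted F hJK hec he0 heres hsurj).1
  · -- `el 0 = 1`
    exact (groupChart_rows_of_rooted F hJK hec he0 heres hsurj).2.1
  · -- `𝓝 1 ≤ map el (𝓝 0)`: near `1`, residual = rooted (w5's packaged row)
    exact (groupChart_rows_of_rooted F hJK hec he0 heres hsurj).2.2
  · -- `𝓝 (σ 0) ≤ map Θ (𝓝 0)`
    rw [hΘ, hσ0]
    exact Filter.le_map fun s hs => hopen s hs
  · -- injectivity on `W`
    rw [hΘ]; exact hinj
  · -- the chart identity
    rw [hΘ]; exact hchart
  · -- `0 < ∫_{ball 0 ρ} J(z,0) dz`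
    have hballW' : ∀ z ∈ closedBall (0 : EuclideanSpace ℝ (Fin dZ)) ρ, ((z, (0 : EuclideanSpace ℝ (Fin dV))) : _ × _) ∈ W :=
      fun z hz => hballW (Set.mk_mem_prod hz rfl)
    have hcontJ : ContinuousOn (fun z : EuclideanSpace ℝ (Fin dZ) => Jd (z, 0)) (closedBall 0 ρ) :=
      hJc.comp (Continuous.continuousOn (continuous_id.prodMk continuous_const)) fun z hz => hballW' z hz
    have hint : IntegrableOn (fun z : EuclideanSpace ℝ (Fin dZ) => Jd (z, 0)) (ball 0 ρ) volume :=
      (hcontJ.integrableOn_compact (isCompact_closedBall _ _)).mono_set ball_subset_closedBall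
    have hvol : 0 < (volume (ball (0 : EuclideanSpace ℝ (Fin dZ)) ρ)).toReal :=
      ENNReal.toReal_pos (measure_ball_pos volume _ hρpos).ne' measure_ball_lt_top.ne
    have hconst : ∫ z in ball (0 : EuclideanSpace ℝ (Fin dZ)) ρ, Jd (0, 0) / 2 = (volume (ball (0 : EuclideanSpace ℝ (Fin dZ)) ρ)).toReal * (Jd (0, 0) / 2) := by
      rw [setIntegral_const, smul_eq_mul]; rfl
    calc (0 : ℝ) < (volume (ball (0 : EuclideanSpace ℝ (Fin dZ)) ρ)).toReal * (Jd (0, 0) / 2) := mul_pos hvol (by linarith)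
      _ = ∫ z in ball (0 : EuclideanSpace ℝ (Fin dZ)) ρ, Jd (0, 0) / 2 := hconst.symm
      _ ≤ ∫ z in ball (0 : EuclideanSpace ℝ (Fin dZ)) ρ, Jd (z, 0) :=
          setIntegral_mono_on (integrableOn_const measure_ball_lt_top.ne) hint measurableSet_ball fun z hz => hlow z hz

/-- ★★★ **THE (C3β″) CHART, DOCKED, SMOOTH EDITION** (v2 append: the same rows plus `ContDiff ℝ ⊤ σ` as a matrix-valued map, from
✓`…TubularChartActSmooth.exists_tubularHaarChart_act_smooth`) —: for `S := residualSubgroup F hJK`, `act := pivotAct F hJK (iterCentralBond (K − J))` and every base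
point `U₀`, Euclidean models `ℝ^{dZ}`, `ℝ^{dV}` at the letter's dimensions, `e : ℝ^{dZ} → ↥S × SU(2)^{pivots}` continuous with `e 0 = 1` and `𝓝 1 ≤ map e (𝓝 0)`, a
continuous transversal `σ` through `U₀` with `𝓝 (σ 0) ≤ map (act ∘ (e × σ)) (𝓝 0)`, an open window `W` on which `act (e ·) (σ ·)` is injective, a density
`Jd ≥ 0` continuous on `W` with `dU|_{image} = Θ_*((Jd · vol ⊗ vol)|_W)`, and a radius `ρ > 0` with `closedBall 0 ρ ×ˢ {0} ⊆ W` and `0 < ∫_{ball 0 ρ} Jd(z,0) dz`.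
[cite: Balaban1985Variational, Thm 1 (8)-(10) p.279; Helgason2000, Ch. I §1 Thm 1.14 (13) p.96; Balaban1985Averaging, (8), (10) p.18] -/
theorem exists_tubularHaarChart_pivotAct_smooth (hk : K - J ≤ (F.P K).m + (F.P K).K) (dZ dV : ℕ)
    (hdZ : dZ = Module.finrank ℝ (specialUnitaryLogChart (Fin 2)).lie *
      ((Fintype.card (Site (F.P K) 0) - Fintype.card (Site (F.P K) (K - J))) + Fintype.card (PBond (F.P K) (K - J))))
    (hdV : dV = Module.finrank ℝ (specialUnitaryLogChart (Fin 2)).lie *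
        (Fintype.card (PBond (F.P K) 0) - Fintype.card (PBond (F.P K) (K - J))) -
      Module.finrank ℝ (specialUnitaryLogChart (Fin 2)).lie * (Fintype.card (Site (F.P K) 0) - Fintype.card (Site (F.P K) (K - J))))
    (U₀ : GaugeField (F.P K) 0 (Matrix.specialUnitaryGroup (Fin 2) ℂ)) :
    ∃ (e : EuclideanSpace ℝ (Fin dZ) → residualSubgroup F hJK × (PBond (F.P K) (K - J) → Matrix.specialUnitaryGroup (Fin 2) ℂ))
      (σ : EuclideanSpace ℝ (Fin dV) → GaugeField (F.P K) 0 (Matrix.specialUnitaryGroup (Fin 2) ℂ))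
      (W : Set (EuclideanSpace ℝ (Fin dZ) × EuclideanSpace ℝ (Fin dV)))
      (Jd : EuclideanSpace ℝ (Fin dZ) × EuclideanSpace ℝ (Fin dV) → ℝ) (ρ : ℝ),
      Continuous e ∧ e 0 = 1 ∧
      𝓝 (1 : residualSubgroup F hJK × (PBond (F.P K) (K - J) → Matrix.specialUnitaryGroup (Fin 2) ℂ)) ≤ map e (𝓝 0) ∧
      Continuous σ ∧ σ 0 = U₀ ∧
      ContDiff ℝ ⊤ (fun y : EuclideanSpace ℝ (Fin dV) => fun b : PBond (F.P K) 0 =>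
        ((σ y b : Matrix.specialUnitaryGroup (Fin 2) ℂ) : Matrix (Fin 2) (Fin 2) ℂ)) ∧
      𝓝 (σ 0) ≤ map (fun p : EuclideanSpace ℝ (Fin dZ) × EuclideanSpace ℝ (Fin dV) =>
        pivotAct F hJK (iterCentralBond (P := F.P K) (K - J)) (e p.1) (σ p.2)) (𝓝 0) ∧
      IsOpen W ∧
      InjOn (fun p : EuclideanSpace ℝ (Fin dZ) × EuclideanSpace ℝ (Fin dV) =>
        pivotAct F hJK (iterCentralBond (P := F.P K) (K - J)) (e p.1) (σ p.2)) W ∧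
      ContinuousOn Jd W ∧ (∀ w ∈ W, 0 ≤ Jd w) ∧
      (fieldMeasure (F.P K) 0 (Matrix.specialUnitaryGroup (Fin 2) ℂ)).restrict
          ((fun p : EuclideanSpace ℝ (Fin dZ) × EuclideanSpace ℝ (Fin dV) =>
            pivotAct F hJK (iterCentralBond (P := F.P K) (K - J)) (e p.1) (σ p.2)) '' W) =
        ((((volume : Measure (EuclideanSpace ℝ (Fin dZ))).prod (volume : Measure (EuclideanSpace ℝ (Fin dV)))).restrict W).withDensity
            fun w => ENNReal.ofReal (Jd w)).map
          (fun p : EuclideanSpace ℝ (Fin dZ) × EuclideanSpace ℝ (Fin dV) =>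
            pivotAct F hJK (iterCentralBond (P := F.P K) (K - J)) (e p.1) (σ p.2)) ∧
      0 < ρ ∧ closedBall (0 : EuclideanSpace ℝ (Fin dZ)) ρ ×ˢ {(0 : EuclideanSpace ℝ (Fin dV))} ⊆ W ∧
      0 < ∫ z in ball (0 : EuclideanSpace ℝ (Fin dZ)) ρ, Jd (z, 0) := by
  obtain ⟨e, σ, W, Jd, ρ₀, hec, he0, heres, hsurj, hσc, hσ0, hσs, hWo, hρ₀, hball, hinj, hopen, hJc, hJ0, hJpos, hchart⟩ :=
    exists_tubularHaarChart_act_smooth (F.P K) hk dZ dV hdZ hdV U₀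
  -- lift `e` into the subgroup (rooted ⇒ residual, px11's GAP 4)
  set el : EuclideanSpace ℝ (Fin dZ) → residualSubgroup F hJK × (PBond (F.P K) (K - J) → Matrix.specialUnitaryGroup (Fin 2) ℂ) :=
    fun z => (⟨(e z).1, residual_of_isResidual F hJK (heres z)⟩, (e z).2) with hel
  -- the action of record through the lift IS the letter's tube map (definitionally)
  have hΘ : (fun p : EuclideanSpace ℝ (Fin dZ) × EuclideanSpace ℝ (Fin dV) =>
      pivotAct F hJK (iterCentralBond (P := F.P K) (K - J)) (el p.1) (σ p.2)) =
      fun p => Function.extend (iterCentralBond (P := F.P K) (K - J)) (fun c => (e p.1).2 c * σ p.2 (iterCentralBond (P := F.P K) (K - J) c))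
        (GaugeField.gaugeAct (e p.1).1 (σ p.2)) := by
    funext p; rfl
  -- (0,0) ∈ W and continuity of `Jd` there; shrink the radius so that `J(z,0) > J(0,0)/2` on the ball
  have h0W : ((0 : EuclideanSpace ℝ (Fin dZ)), (0 : EuclideanSpace ℝ (Fin dV))) ∈ W :=
    hball (Set.mk_mem_prod (Metric.mem_closedBall_self hρ₀.le) rfl)
  have hJat : ContinuousAt Jd ((0 : EuclideanSpace ℝ (Fin dZ)), (0 : EuclideanSpace ℝ (Fin dV))) :=
    hJc.continuousAt (hWo.mem_nhds h0W)
  obtain ⟨δ, hδ, hδJ⟩ := Metric.continuousAt_iff.1 hJat (Jd (0, 0) / 2) (by linarith)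
  set ρ : ℝ := min ρ₀ (δ / 2) with hρ
  have hρpos : 0 < ρ := lt_min hρ₀ (by linarith)
  have hρle : ρ ≤ ρ₀ := min_le_left _ _
  have hρδ : ρ < δ := lt_of_le_of_lt (min_le_right _ _) (by linarith)
  have hballW : closedBall (0 : EuclideanSpace ℝ (Fin dZ)) ρ ×ˢ {(0 : EuclideanSpace ℝ (Fin dV))} ⊆ W :=
    (Set.prod_mono (Metric.closedBall_subset_closedBall hρle) Subset.rfl).trans hball
  -- lower bound `J(z,0) ≥ J(0,0)/2` on the ball
  have hlow : ∀ z ∈ ball (0 : EuclideanSpace ℝ (Fin dZ)) ρ, Jd (0, 0) / 2 ≤ Jd (z, 0) := by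
    intro z hz
    have hd : dist ((z, (0 : EuclideanSpace ℝ (Fin dV))) : EuclideanSpace ℝ (Fin dZ) × EuclideanSpace ℝ (Fin dV)) (0, 0) < δ := by
      rw [Prod.dist_eq, dist_self]
      exact max_lt (lt_trans (mem_ball.1 hz) hρδ) hδ
    have := hδJ hd
    rw [Real.dist_eq] at this
    have := (abs_lt.1 this).1
    linarith
  refine ⟨el, σ, W, Jd, ρ, ?_, ?_, ?_, hσc, hσ0, hσs, ?_, hWo, ?_, hJc, hJ0, ?_, hρpos, hballW, ?_⟩
  · -- `el` continuous (w5's packaged row)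
    exact (groupChart_rows_of_rooted F hJK hec he0 heres hsurj).1
  · -- `el 0 = 1`
    exact (groupChart_rows_of_rooted F hJK hec he0 heres hsurj).2.1
  · -- `𝓝 1 ≤ map el (𝓝 0)`: near `1`, residual = rooted (w5's packaged row)
    exact (groupChart_rows_of_rooted F hJK hec he0 heres hsurj).2.2
  · -- `𝓝 (σ 0) ≤ map Θ (𝓝 0)`
    rw [hΘ, hσ0]
    exact Filter.le_map fun s hs => hopen s hs
  · -- injectivity on `W`
    rw [hΘ]; exact hinj
  · -- the chart identity
    rw [hΘ]; exact hchart
  · -- `0 < ∫_{ball 0 ρ} J(z,0) dz`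
    have hballW' : ∀ z ∈ closedBall (0 : EuclideanSpace ℝ (Fin dZ)) ρ, ((z, (0 : EuclideanSpace ℝ (Fin dV))) : _ × _) ∈ W :=
      fun z hz => hballW (Set.mk_mem_prod hz rfl)
    have hcontJ : ContinuousOn (fun z : EuclideanSpace ℝ (Fin dZ) => Jd (z, 0)) (closedBall 0 ρ) :=
      hJc.comp (Continuous.continuousOn (continuous_id.prodMk continuous_const)) fun z hz => hballW' z hz
    have hint : IntegrableOn (fun z : EuclideanSpace ℝ (Fin dZ) => Jd (z, 0)) (ball 0 ρ) volume :=
      (hcontJ.integrableOn_compact (isCompact_closedBall _ _)).mono_set ball_subset_closedBall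
    have hvol : 0 < (volume (ball (0 : EuclideanSpace ℝ (Fin dZ)) ρ)).toReal :=
      ENNReal.toReal_pos (measure_ball_pos volume _ hρpos).ne' measure_ball_lt_top.ne
    have hconst : ∫ z in ball (0 : EuclideanSpace ℝ (Fin dZ)) ρ, Jd (0, 0) / 2 = (volume (ball (0 : EuclideanSpace ℝ (Fin dZ)) ρ)).toReal * (Jd (0, 0) / 2) := by
      rw [setIntegral_const, smul_eq_mul]; rfl
    calc (0 : ℝ) < (volume (ball (0 : EuclideanSpace ℝ (Fin dZ)) ρ)).toReal * (Jd (0, 0) / 2) := mul_pos hvol (by linarith)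
      _ = ∫ z in ball (0 : EuclideanSpace ℝ (Fin dZ)) ρ, Jd (0, 0) / 2 := hconst.symm
      _ ≤ ∫ z in ball (0 : EuclideanSpace ℝ (Fin dZ)) ρ, Jd (z, 0) :=
          setIntegral_mono_on (integrableOn_const measure_ball_lt_top.ne) hint measurableSet_ball fun z hz => hlow z hz

end Summit.QuantumFields.YangMills.Theorems.FluctuationComparisonRegPrIntLS2BetaTubularChartDock

end
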